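import Summits.KontsevichZagierPeriods.KontsevichZagierPeriods.Theorems.AbelContractionRealHyperellipticSectorBudgetKit
import Summits.KontsevichZagierPeriods.KontsevichZagierPeriods.Theorems.TerasomaMultiplicationBetaCancellationStubAffineMove

/-!
# Route AbelContraction — `RealHyperellipticSector` (crux stmt-KontsevichZagierPeriods-12475):
# the dimension-certified port, layer 1 — kit and the affine move

Helper file of the line `Lines/birth.lean` (stub `stub_bakerAlg`, `--supports` the crux). The stub
`stub_bakerAlg` is the tree's "Kontsevich–Zagier Conjecture 1 in dimension `≤ 1`"
(`…HurwitzMicroSectorsNormalFormPrinciple*`, namespace `…NormalFormPrinciple.PiBox`) re-proved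
INSIDE the budget `KZ.relationsLE 1` (every move among representations of dimension `≤ 1`,
Newton–Leibniz only `1 → 0`) instead of `KZ.relations`. This is the first file of that port
(namespace `…RealHyperellipticSector.Port`, same sub-namespaces and names as the originals with
`relations ↦ relationsLE`):

* `Port.Kit` — the generic budget bookkeeping the later layers call and which is not already in
  `…BudgetKit.lean` / `AbelContractionAbelContractionLemma.lean`: `[r] + [r.neg]` and, more
  generally, `[σ, f] + [σ, −f]`, are truncated relations (`Kit.of_add_of_neg_mem_relationsLE`,
  `Kit.of_add_of_mem_relationsLE_of_eqOn_neg`, the budget forms of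
  `KZ.of_add_of_mem_relations_of_eqOn_neg`);
* `Port.affineMove_mem_relationsLE` (registered sub-goal) — the affine move of
  `TerasomaMultiplicationBetaCancellationStubAffineMove.lean` (`stub_affineMove`: the substitution
  `x = s·m + c`, ONE rule-(2) move between two interval representations of dimension `1`) with the
  conclusion `KZ.Equivalent T A` sharpened to `[T] − [A] ∈ relationsLE 1`. The chart lemmas
  `aff_*` of that file are dimension-free and reused as they are.

References: M. Kontsevich, D. Zagier, *Periods* (2001), §1.2 rules (1)–(2) [KontsevichZagier2001].
No definitions are introduced.
-/

noncomputable section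

open Set MeasureTheory
open Literature.ModelTheory.ExponentialFields (IsSemialgebraic)
open Literature.NumberTheory.Transcendental Literature.NumberTheory.Transcendental.KZ
open Summit.KontsevichZagierPeriods.AbelContraction.AbelContractionLemma
  (mem_relationsLE_of_integrandAdd of_mem_relationsLE_of_eqOn_zero)
open Summit.KontsevichZagierPeriods.KontsevichZagierPeriods.BetaCancellationLine
  (aff_hasFDerivAt_chart aff_abs_det_chartDeriv aff_injective_chart aff_isSemialgebraicMapOn_chart
    aff_image_chart aff_kernel_identity)

namespace Summit.KontsevichZagierPeriods.AbelContraction.RealHyperellipticSector.Port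

/-! ## Kit: opposite integrands inside a budget -/

namespace Kit

variable {k d : ℕ}

/-- **`[r] + [r.neg]` is a truncated relation** for a representation of dimension `k ≤ d`
(rule (1b) with the zero representation: `[σ, 0] ≡ [σ, f] + [σ, −f]`, and `[σ, 0] ≡ 0`)
(inside the budget `relationsLE d`). [cite: KontsevichZagier2001, §1.2 rule (1)] -/
theorem of_add_of_neg_mem_relationsLE (hk : k ≤ d) (r : IntegralRep k) :
    of r + of r.neg ∈ relationsLE d := by
  obtain ⟨z, hzd, hzi⟩ := exists_zeroRep r.isSemialgebraic_domain
  have h1 : of z - of r - of r.neg ∈ relationsLE d :=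
    mem_relationsLE_of_integrandAdd hk hzd.symm (by simp [hzd]) fun x _ => by simp [hzi]
  have h2 : of z ∈ relationsLE d := of_mem_relationsLE_of_eqOn_zero hk z (by simp [hzi, EqOn])
  have e : of r + of r.neg = of z - (of z - of r - of r.neg) := by abel
  rw [e]
  exact (relationsLE d).sub_mem h2 h1

/-- **Two representations of dimension `k ≤ d` with the same domain and opposite integrands on it
sum to a truncated relation** (the budget form of `KZ.of_add_of_mem_relations_of_eqOn_neg`)
(inside the budget `relationsLE d`). [cite: KontsevichZagier2001, §1.2 rule (1)] -/
theorem of_add_of_mem_relationsLE_of_eqOn_neg (hk : k ≤ d) {r r' : IntegralRep k}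
    (hd : r'.domain = r.domain) (h : EqOn r'.integrand (-r.integrand) r.domain) :
    of r + of r' ∈ relationsLE d := by
  have h1 : of r + of r.neg ∈ relationsLE d := of_add_of_neg_mem_relationsLE hk r
  have h2 : of r.neg - of r' ∈ relationsLE d :=
    Budget.congr_mem_relationsLE hk (by simp [hd]) fun x hx => (h hx).symm
  have e : of r + of r' = (of r + of r.neg) - (of r.neg - of r') := by abel
  rw [e]
  exact (relationsLE d).sub_mem h1 h2

end Kit

/-! ## The affine move inside the budget -/

/-- **The affine move inside dimension one** (port of `stub_affineMove`, line
`dirichlet-companion-to-pi` of crux stmt-KontsevichZagierPeriods-13633): the affine substitution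
`x = s·m + c` (`s > 0`, `c`, `s` real algebraic, `c² + s² = 1`) is ONE rule-(2) move between the
interval representations `T = [(0,1), κ s/(x²−2cx+1)]` and `A = [((0−c)/s, (1−c)/s), κ/(1+m²)]`,
both of dimension `1`; hence `[T] − [A] ∈ relationsLE 1` (inside the budget `relationsLE 1`).
(The hypothesis that `κ` is algebraic is not used: both representations are given.)
[cite: KontsevichZagier2001, §1.2 rule (2)] -/
theorem affineMove_mem_relationsLE : ∀ (c s κ : ℝ), IsAlgebraic ℚ c → IsAlgebraic ℚ s →
    IsAlgebraic ℚ κ → 0 < s → c ^ 2 + s ^ 2 = 1 → ∀ (T A : KZ.IntegralRep 1),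
    T.domain = {x | x 0 ∈ Set.Ioo (0:ℝ) 1} →
    Set.EqOn T.integrand (fun x => κ * s / ((x 0) ^ 2 - 2 * c * (x 0) + 1)) T.domain →
    A.domain = {x | x 0 ∈ Set.Ioo ((0 - c) / s) ((1 - c) / s)} →
    Set.EqOn A.integrand (fun x => κ / (1 + (x 0) ^ 2)) A.domain →
    KZ.of T - KZ.of A ∈ KZ.relationsLE 1 := by
  intro c s κ hc hs_alg _ hs h T A hTd hTi hAd hAi
  -- the chart maps `A.domain` onto `T.domain`
  have himage : T.domain =
      (fun y : Fin 1 → ℝ => fun _ : Fin 1 => s * y 0 + c) '' A.domain := by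
    rw [hAd, aff_image_chart hs c, hTd]
  -- ONE change-of-variables move among representations of dimension `1`
  have hcov : of A - of T ∈ relationsLE 1 := by
    refine Budget.changeOfVariables_mem_relationsLE le_rfl
      (fun y : Fin 1 → ℝ => fun _ : Fin 1 => s * y 0 + c)
      (fun _ => s • ContinuousLinearMap.id ℝ (Fin 1 → ℝ))
      (aff_isSemialgebraicMapOn_chart A.isSemialgebraic_domain hc hs_alg)
      (fun x _ => (aff_hasFDerivAt_chart s c x).hasFDerivWithinAt)
      (aff_injective_chart hs.ne' c).injOn himage fun x hx => ?_
    -- the pull-back identity on `A.domain`, Jacobian `|det (s • id)| = s` included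
    have hΦx : (fun _ : Fin 1 => s * x 0 + c) ∈ T.domain := himage ▸ mem_image_of_mem _ hx
    rw [hAi hx, hTi hΦx, aff_abs_det_chartDeriv hs]
    exact aff_kernel_identity κ (x 0) hs h
  have e : of T - of A = -(of A - of T) := by abel
  rw [e]
  exact (relationsLE 1).neg_mem hcov

end Summit.KontsevichZagierPeriods.AbelContraction.RealHyperellipticSector.Port

end
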